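import Summits.NavierStokesRegularity.NavierStokesRegularity.Theorems.TypeIQuarterGateQuarterLawTypeIWindowLaw
import Literature.Analysis.FluidPDE.LerayHopfSpatialGradient
import Literature.Analysis.FluidPDE.ClassicalSuitable
import Literature.Analysis.FluidPDE.NSSuitableESSProofs
import HarnessLib

/-!
# `TypeIQuarterGate`: the backward parabolic window controls the slice enstrophy of a Type-I
# blow-up; the enstrophy is `o((T−t)⁻¹)` (crux `QuarterLawTypeI`, stmt-NavierStokesRegularity-23726)

`--supports stmt-NavierStokesRegularity-23726` (helper).  The registered line `lorentz-upgrade` of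
the crux K1 = `QuarterLawTypeI` is at its fixed point (its one open stub `stub_lorentzUpgrade` is the
item `LorentzUpgradeTypeI` ⟺ K1, tree `LorentzOfEnvelope.lorentzUpgradeTypeI_iff_quarterLawTypeI`), so
this file sharpens the known a-priori information on K1's conclusion instead.

Along a classical Leray–Hopf solution on `[0,T)` from a rapidly decaying datum with the sup-norm
Type-I rate `√(T−t)‖u(t,x)‖ ≤ C√ν` near `T`, write `Z(t) := ∫‖curl u(t)‖²` and `c := e^{C'²/2}`,
`C' = max C 1`.

* `lintegral_curl_sq_le_exp_div_mul_window` — **BACKWARD-WINDOW TRANSFER**: for `t` near `T`,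
  `Z(t) ≤ (c/(T−t)) · ∫_{2t−T}^{t} Z(s) ds`.
  The backward window `[2t−T, t]` has the parabolic length `δ = T−t`; on it the rate gives
  `|u| ≤ C'√ν/√δ`, so the endpoint-Serrin Grönwall factor from ANY slice of the window to `t`
  (tree `QuarterLawWindow.lintegral_frobeniusNormSq_le_exp_mul_of_bound`) is at most `c`, uniformly in
  `δ`; and some slice carries at most the window average.  This is the mechanism of the tree's
  `QuarterLawWindow.quarterLaw_of_terminalWindowLaw_of_rate` (p820364), isolated as an inequality with
  the EXACT window integral on the right, so that any information on the dissipation over the last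
  parabolic window transfers to the slice: a window law `∫_a^T Z ≤ ω(T−a)` gives `Z(t) ≤ c·ω(2(T−t))/(T−t)`
  (`ω(r) = K√r` is K1; `ω = const` is the exponent-`1` cap).
* `lintegral_Ioo_lintegral_curl_sq_lt_top` — the total dissipation `∫₀ᵀ Z < ∞` in K1's `curl`/`lintegral`
  currency (the classical gradient is a weak spatial gradient on the open slab, hence agrees a.e. with
  the square-integrable Leray–Hopf gradient; slice-wise `∫|∇u|²_F = ∫‖curl u‖²`).
* `exists_window_lt` — hence the dissipation over terminal windows `∫_a^T Z` is small for `a` near `T`.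
* `lintegral_curl_sq_le_eps_div` and, BY NAME under K1's hypotheses verbatim,
  `enstrophy_isLittleO_inv_of_isTypeIBlowup` — **`Z(t) = o((T−t)⁻¹)`**: for every `ε > 0` there is
  `t₀ < T` with `Z(t) ≤ ε/(T−t)` on `[t₀,T)`.  So in the enstrophy EXPONENT WINDOW of a (hypothetical)
  sup-norm Type-I blow-up, `1/2 ≤ a(C) ≤ min(1, κ²C²/2)` (tree `QuarterLawExponent.enstrophyCapTypeI`,
  `…lintegral_curl_sq_le_rpow_sharp_of_rate`, Leray's floor), the cap `a = 1` is NEVER attained: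
  `(T−t)·Z(t) → 0`.  K1 is the statement `√(T−t)·Z(t) = O(1)`; between `o((T−t)⁻¹)` and
  `O((T−t)^{-1/2})` nothing is claimed.

HONEST FRAMING: a-priori bookkeeping along a HYPOTHETICAL blow-up; `QuarterLawTypeI` (23726),
`LorentzUpgradeTypeI` (24108), `UniformConcentrationCountTypeI` (23970) remain OPEN; nothing about
Navier–Stokes regularity is claimed and no summit statement is proved. [folklore]
-/

-- the problem directory repeats the summit name (`NavierStokesRegularity/NavierStokesRegularity`)
set_option linter.dupNamespace false

noncomputable section

open Set Filter Topology MeasureTheory Function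
open scoped ENNReal NNReal ContDiff

namespace Summit.NavierStokesRegularity.NavierStokesRegularity.Theorems

namespace QuarterLawBackwardWindow

open Literature.Analysis.FluidPDE
open Summit.NavierStokesRegularity.NavierStokesRegularity.Theorems.QuarterLawWindow
  (lintegral_frobeniusNormSq_le_exp_mul_of_bound lintegral_frobeniusNormSq_eq_lintegral_curl_sq
    exists_rate_of_isTypeIBlowup')

/-! ### The backward-window transfer under the rate -/

/-- **Backward-window transfer.** Along a classical Leray–Hopf rapidly-decaying-datum solution on
`[0,T)` (`ν, T > 0`) with eventual rate `√(T−t)‖u(t,x)‖ ≤ C√ν`: there is `t₁ ∈ [T/2, T)` such that for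
every `t ∈ [t₁, T)`
`∫‖curl u(t)‖² ≤ (e^{(max C 1)²/2}/(T−t)) · ∫_{2t−T}^{t} ∫‖curl u(s)‖² ds`. [folklore] -/
theorem lintegral_curl_sq_le_exp_div_mul_window {ν T C : ℝ} (hν : 0 < ν) (hT : 0 < T)
    {u : ℝ → EuclideanSpace ℝ (Fin 3) → EuclideanSpace ℝ (Fin 3)}
    {p : ℝ → EuclideanSpace ℝ (Fin 3) → ℝ}
    (hsol : IsClassicalNSSolutionOn (Ico 0 T) ν 0 u p) (hLH : IsLerayHopfOn T ν 0 (u 0) u)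
    (hdec : HasRapidSpatialDecay (u 0))
    (hrate : ∀ᶠ t in 𝓝[<] T, ∀ x, Real.sqrt (T - t) * ‖u t x‖ ≤ C * Real.sqrt ν) :
    ∃ t₁ ∈ Ico 0 T, T ≤ 2 * t₁ ∧ ∀ t ∈ Ico t₁ T,
      ∫⁻ x, ‖curl (u t) x‖ₑ ^ 2 ≤
        ENNReal.ofReal (Real.exp ((max C 1) ^ 2 / 2) / (T - t)) *
          ∫⁻ s in Ioo (2 * t - T) t, ∫⁻ x, ‖curl (u s) x‖ₑ ^ 2 := by
  -- the onset of the rate, and a positive rate constant `C' = max C 1`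
  obtain ⟨a₀, ha₀T, hsub⟩ := mem_nhdsLT_iff_exists_Ioo_subset.1 hrate
  set C' : ℝ := max C 1 with hC'
  have hC'0 : 0 < C' := lt_of_lt_of_le one_pos (le_max_right _ _)
  have hrate' : ∀ σ ∈ Ioo a₀ T, ∀ x, Real.sqrt (T - σ) * ‖u σ x‖ ≤ C' * Real.sqrt ν :=
    fun σ hσ x => (hsub hσ x).trans
      (mul_le_mul_of_nonneg_right (le_max_left _ _) (Real.sqrt_nonneg _))
  -- the final stretch `[t₁, T)`, `t₁ = (T + max a₀ 0)/2`
  set t₁ : ℝ := (T + max a₀ 0) / 2 with ht₁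
  have hm : max a₀ 0 < T := max_lt ha₀T hT
  have hm0 : 0 ≤ max a₀ 0 := le_max_right _ _
  have ht₁T : t₁ < T := by rw [ht₁]; linarith
  have ht₁0 : 0 ≤ t₁ := by rw [ht₁]; linarith
  have hTt₁ : T ≤ 2 * t₁ := by rw [ht₁]; linarith
  refine ⟨t₁, ⟨ht₁0, ht₁T⟩, hTt₁, fun t ht => ?_⟩
  set c : ℝ := Real.exp (C' ^ 2 / 2) with hc
  have hc0 : 0 < c := Real.exp_pos _
  -- the backward window `(a, t)`, `a = 2t − T`, of length `δ = T − t`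
  set δ : ℝ := T - t with hδ
  have hδ0 : 0 < δ := by rw [hδ]; linarith [ht.2]
  have hsδ : 0 < Real.sqrt δ := Real.sqrt_pos.2 hδ0
  set a : ℝ := 2 * t - T with ha_def
  have hat : a = t - δ := by rw [ha_def, hδ]; ring
  have hma : max a₀ 0 ≤ a := by
    have h1 := ht.1
    rw [ht₁] at h1
    rw [ha_def]; linarith
  have ha0 : 0 ≤ a := hm0.trans hma
  have haa₀ : a₀ ≤ a := (le_max_left a₀ 0).trans hma
  have hta : t - a = δ := by rw [hat]; ring
  set W : ℝ≥0∞ := ∫⁻ s in Ioo a t, ∫⁻ x, ‖curl (u s) x‖ₑ ^ 2 with hW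
  -- trivial when the window integral is infinite
  rcases eq_or_ne W ⊤ with hWtop | hWtop
  · have hne : ENNReal.ofReal (c / (T - t)) ≠ 0 := by
      rw [← hδ]; exact (ENNReal.ofReal_pos.2 (div_pos hc0 hδ0)).ne'
    rw [hWtop, ENNReal.mul_top hne]
    exact le_top
  -- `W` finite: work with `w = W.toReal`
  set w : ℝ := W.toReal with hw
  have hWeq : W = ENNReal.ofReal w := (ENNReal.ofReal_toReal hWtop).symm
  have hw0 : 0 ≤ w := ENNReal.toReal_nonneg
  -- the sup bound `|u| ≤ M = C'√ν/√δ` on `[s, t] × ℝ³` for every `s ∈ (a, t)`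
  set M : ℝ := C' * Real.sqrt ν / Real.sqrt δ with hM_def
  have hM0 : 0 < M := by positivity
  have hbdM : ∀ s ∈ Ioo a t, ∀ σ ∈ Icc s t, ∀ x, ‖u σ x‖ ≤ M := by
    intro s hs σ hσ x
    have hσT : σ < T := hσ.2.trans_lt ht.2
    have hσa₀ : a₀ < σ := haa₀.trans_lt (hs.1.trans_le hσ.1)
    have hsσ : 0 < Real.sqrt (T - σ) := Real.sqrt_pos.2 (sub_pos.2 hσT)
    have h1 := hrate' σ ⟨hσa₀, hσT⟩ x
    have h2 : ‖u σ x‖ ≤ C' * Real.sqrt ν / Real.sqrt (T - σ) := by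
      rw [le_div_iff₀ hsσ, mul_comm]; exact h1
    refine h2.trans ?_
    rw [hM_def]
    refine div_le_div_of_nonneg_left (by positivity) hsδ (Real.sqrt_le_sqrt ?_)
    have hσt : σ ≤ t := hσ.2
    rw [hδ]; linarith
  -- the Grönwall exponent over at most one parabolic unit is `≤ C'²/2`
  have hexpM : ∀ s ∈ Ioo a t, Real.exp (M ^ 2 * (t - s) / (2 * ν)) ≤ c := by
    intro s hs
    rw [hc]
    refine Real.exp_le_exp.2 ?_
    have hts : t - s ≤ δ := by
      have hs1 := hs.1
      rw [hat] at hs1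
      linarith
    have hM2 : M ^ 2 = C' ^ 2 * ν / δ := by
      rw [hM_def, div_pow, mul_pow, Real.sq_sqrt hν.le, Real.sq_sqrt hδ0.le]
    rw [hM2, div_le_div_iff₀ (by positivity) (by norm_num)]
    have h1 : C' ^ 2 * ν / δ * (t - s) ≤ C' ^ 2 * ν / δ * δ :=
      mul_le_mul_of_nonneg_left hts (by positivity)
    rw [div_mul_cancel₀ _ hδ0.ne'] at h1
    nlinarith [h1, hν]
  -- Grönwall from any slice `s ∈ (a, t)`: `Z(t) ≤ c · Z(s)`
  have hgr : ∀ s ∈ Ioo a t, ∫⁻ x, ‖curl (u t) x‖ₑ ^ 2 ≤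
      ENNReal.ofReal c * ∫⁻ x, ‖curl (u s) x‖ₑ ^ 2 := by
    intro s hs
    have hs0 : 0 ≤ s := ha0.trans hs.1.le
    have hsT : s ∈ Ico 0 T := ⟨hs0, hs.2.trans ht.2⟩
    have htT : t ∈ Ico 0 T := ⟨hs0.trans hs.2.le, ht.2⟩
    have h := lintegral_frobeniusNormSq_le_exp_mul_of_bound hν hsol hLH hdec hs0 hs.2 ht.2 hM0
      (hbdM s hs)
    rw [lintegral_frobeniusNormSq_eq_lintegral_curl_sq hν hT hsol hLH hdec htT,
      lintegral_frobeniusNormSq_eq_lintegral_curl_sq hν hT hsol hLH hdec hsT] at h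
    exact h.trans (mul_le_mul_left (ENNReal.ofReal_le_ofReal (hexpM s hs)) _)
  -- a good slice for every `η > 0`: `Z(s) ≤ (w + η)/δ`
  have hgood : ∀ η : ℝ, 0 < η → ∃ s ∈ Ioo a t,
      ∫⁻ x, ‖curl (u s) x‖ₑ ^ 2 ≤ ENNReal.ofReal ((w + η) / δ) := by
    intro η hη
    by_contra hne
    push Not at hne
    have hlow : ENNReal.ofReal ((w + η) / δ) * volume (Ioo a t) ≤ W := by
      rw [hW, ← setLIntegral_const]
      exact setLIntegral_mono' measurableSet_Ioo fun s hs => (hne s hs).le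
    have hwd : 0 ≤ (w + η) / δ := by positivity
    rw [Real.volume_Ioo, hta, ← ENNReal.ofReal_mul hwd, div_mul_cancel₀ _ hδ0.ne', hWeq,
      ENNReal.ofReal_le_ofReal_iff hw0] at hlow
    linarith
  -- `Z(t) ≤ c (w + η)/δ` for every `η > 0`
  have key : ∀ η : ℝ, 0 < η →
      ∫⁻ x, ‖curl (u t) x‖ₑ ^ 2 ≤ ENNReal.ofReal (c / δ * w + c / δ * η) := by
    intro η hη
    obtain ⟨s, hs, hZs⟩ := hgood η hη
    calc ∫⁻ x, ‖curl (u t) x‖ₑ ^ 2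
        ≤ ENNReal.ofReal c * ∫⁻ x, ‖curl (u s) x‖ₑ ^ 2 := hgr s hs
      _ ≤ ENNReal.ofReal c * ENNReal.ofReal ((w + η) / δ) := mul_le_mul_right hZs _
      _ = ENNReal.ofReal (c / δ * w + c / δ * η) := by
          rw [← ENNReal.ofReal_mul hc0.le]
          congr 1
          field_simp
  -- let `η → 0`
  have hfin : ENNReal.ofReal (c / δ) * W = ENNReal.ofReal (c / δ * w) := by
    rw [hWeq, ← ENNReal.ofReal_mul (div_pos hc0 hδ0).le]
  rw [hfin]
  refine ENNReal.le_of_forall_pos_le_add fun ε hε _ => ?_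
  have hcδ : 0 < c / δ := div_pos hc0 hδ0
  have hη : 0 < (ε : ℝ) / (c / δ) := div_pos (by exact_mod_cast hε) hcδ
  have h := key ((ε : ℝ) / (c / δ)) hη
  rw [mul_div_cancel₀ _ hcδ.ne'] at h
  calc ∫⁻ x, ‖curl (u t) x‖ₑ ^ 2 ≤ ENNReal.ofReal (c / δ * w + ε) := h
    _ ≤ ENNReal.ofReal (c / δ * w) + ENNReal.ofReal ε := ENNReal.ofReal_add_le
    _ = ENNReal.ofReal (c / δ * w) + ε := by rw [ENNReal.ofReal_coe_nnreal]

/-! ### The total dissipation is finite in the `curl` currency -/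

/-- **Finite total dissipation, `curl` currency.** Along a classical Leray–Hopf rapidly-decaying-datum
solution on `[0,T)` (`ν, T > 0`): `∫₀ᵀ ∫‖curl u(s)‖² ds < ∞`.  The classical gradient is a weak spatial
gradient on the open slab `(0,T) × ℝ³` (`hasWeakSpatialGradientOn_of_contDiffOn`), so it agrees a.e.
with the square-integrable Leray–Hopf gradient (`IsLerayHopfOn.exists_hasWeakSpatialGradientOn`,
`HasWeakSpatialGradientOn.ae_eq`), and slice-wise `∫|∇u|²_F = ∫‖curl u‖²`
(`QuarterLawWindow.lintegral_frobeniusNormSq_eq_lintegral_curl_sq`). [folklore] -/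
theorem lintegral_Ioo_lintegral_curl_sq_lt_top {ν T : ℝ} (hν : 0 < ν) (hT : 0 < T)
    {u : ℝ → EuclideanSpace ℝ (Fin 3) → EuclideanSpace ℝ (Fin 3)}
    {p : ℝ → EuclideanSpace ℝ (Fin 3) → ℝ}
    (hsol : IsClassicalNSSolutionOn (Ico 0 T) ν 0 u p) (hLH : IsLerayHopfOn T ν 0 (u 0) u)
    (hdec : HasRapidSpatialDecay (u 0)) :
    ∫⁻ s in Ioo 0 T, ∫⁻ x, ‖curl (u s) x‖ₑ ^ 2 < ⊤ := by
  obtain ⟨G', hG'slab, -, -, hG'int⟩ := hLH.exists_hasWeakSpatialGradientOn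
  -- the classical gradient is a weak spatial gradient on the open slab
  have hcd : ContDiffOn ℝ 1 (uncurry u) (Ioo 0 T ×ˢ (univ : Set (EuclideanSpace ℝ (Fin 3)))) :=
    ContDiffOn.of_le (hsol.smooth_velocity.mono Ioo_subset_Ico_self) (by norm_cast)
  have hGu : HasWeakSpatialGradientOn (slab (EuclideanSpace ℝ (Fin 3)) (Ioo 0 T) isOpen_Ioo) u
      fun t x => fderiv ℝ (u t) x :=
    hasWeakSpatialGradientOn_of_contDiffOn isOpen_Ioo (by rw [coe_slab]) hcd
  have hae := hGu.ae_eq hG'slab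
  rw [coe_slab, Measure.volume_eq_prod, ← Measure.prod_restrict] at hae
  have hae' := Measure.ae_ae_of_ae_prod hae
  calc ∫⁻ s in Ioo 0 T, ∫⁻ x, ‖curl (u s) x‖ₑ ^ 2
      = ∫⁻ s in Ioo 0 T, ∫⁻ x, ENNReal.ofReal (frobeniusNormSq (fderiv ℝ (u s) x)) :=
        setLIntegral_congr_fun measurableSet_Ioo fun s hs =>
          (lintegral_frobeniusNormSq_eq_lintegral_curl_sq hν hT hsol hLH hdec ⟨hs.1.le, hs.2⟩).symm
    _ = ∫⁻ s in Ioo 0 T, ∫⁻ x, ENNReal.ofReal (frobeniusNormSq (G' s x)) := by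
        refine lintegral_congr_ae ?_
        filter_upwards [hae'] with s hs
        rw [Measure.restrict_univ] at hs
        refine lintegral_congr_ae ?_
        filter_upwards [hs] with x hx
        simp only [uncurry_apply_pair] at hx
        rw [hx]
    _ < ⊤ := hG'int

/-- **Small terminal dissipation.** For every `ε > 0` there is `a₁ ∈ [0,T)` with
`∫_{a₁}^{T} ∫‖curl u(s)‖² ds < ε` (absolute continuity of the finite dissipation integral,
Mathlib `exists_pos_setLIntegral_lt_of_measure_lt`). [folklore] -/
theorem exists_window_lt {ν T : ℝ} (hν : 0 < ν) (hT : 0 < T)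
    {u : ℝ → EuclideanSpace ℝ (Fin 3) → EuclideanSpace ℝ (Fin 3)}
    {p : ℝ → EuclideanSpace ℝ (Fin 3) → ℝ}
    (hsol : IsClassicalNSSolutionOn (Ico 0 T) ν 0 u p) (hLH : IsLerayHopfOn T ν 0 (u 0) u)
    (hdec : HasRapidSpatialDecay (u 0)) {ε : ℝ≥0∞} (hε : ε ≠ 0) :
    ∃ a₁ ∈ Ico 0 T, ∫⁻ s in Ioo a₁ T, ∫⁻ x, ‖curl (u s) x‖ₑ ^ 2 < ε := by
  have hfin := (lintegral_Ioo_lintegral_curl_sq_lt_top hν hT hsol hLH hdec).ne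
  obtain ⟨δ, hδ0, hδ⟩ := exists_pos_setLIntegral_lt_of_measure_lt
    (μ := volume.restrict (Ioo 0 T)) hfin hε
  -- a real `0 < r` with `ofReal r < δ` and `r ≤ T`
  obtain ⟨r, hr0, hrδ⟩ : ∃ r : ℝ, 0 < r ∧ ENNReal.ofReal r < δ := by
    rcases eq_or_ne δ ⊤ with hδT | hδT
    · exact ⟨1, one_pos, by rw [hδT]; exact ENNReal.ofReal_lt_top⟩
    · have hδr : 0 < δ.toReal := ENNReal.toReal_pos hδ0.ne' hδT
      refine ⟨δ.toReal / 2, by positivity, ?_⟩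
      calc ENNReal.ofReal (δ.toReal / 2) < ENNReal.ofReal δ.toReal :=
            (ENNReal.ofReal_lt_ofReal_iff hδr).2 (by linarith)
        _ = δ := ENNReal.ofReal_toReal hδT
  set a₁ : ℝ := max (T - r) 0 with ha₁
  have ha₁0 : 0 ≤ a₁ := le_max_right _ _
  have ha₁T : a₁ < T := max_lt (by linarith) hT
  refine ⟨a₁, ⟨ha₁0, ha₁T⟩, ?_⟩
  have hmeas : (volume.restrict (Ioo 0 T)) (Ioo a₁ T) < δ := by
    rw [Measure.restrict_apply measurableSet_Ioo]
    calc volume (Ioo a₁ T ∩ Ioo 0 T) ≤ volume (Ioo a₁ T) := measure_mono inter_subset_left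
      _ = ENNReal.ofReal (T - a₁) := Real.volume_Ioo
      _ ≤ ENNReal.ofReal r := ENNReal.ofReal_le_ofReal (by
          have : T - r ≤ a₁ := le_max_left _ _
          linarith)
      _ < δ := hrδ
  have h := hδ _ hmeas
  rwa [Measure.restrict_restrict measurableSet_Ioo,
    Ioo_inter_Ioo, max_eq_left ha₁0, min_self] at h

/-! ### `Z(t) = o((T−t)⁻¹)` -/

/-- **The slice enstrophy of a Type-I blow-up is `o((T−t)⁻¹)`** (rate currency).  Along a classical
Leray–Hopf rapidly-decaying-datum solution on `[0,T)` (`ν, T > 0`) with eventual rate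
`√(T−t)‖u(t,x)‖ ≤ C√ν`: for every `ε > 0` there is `t₀ ∈ [0,T)` with `∫‖curl u(t)‖² ≤ ε/(T−t)` for all
`t ∈ [t₀,T)`. [folklore] -/
theorem lintegral_curl_sq_le_eps_div {ν T C : ℝ} (hν : 0 < ν) (hT : 0 < T)
    {u : ℝ → EuclideanSpace ℝ (Fin 3) → EuclideanSpace ℝ (Fin 3)}
    {p : ℝ → EuclideanSpace ℝ (Fin 3) → ℝ}
    (hsol : IsClassicalNSSolutionOn (Ico 0 T) ν 0 u p) (hLH : IsLerayHopfOn T ν 0 (u 0) u)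
    (hdec : HasRapidSpatialDecay (u 0))
    (hrate : ∀ᶠ t in 𝓝[<] T, ∀ x, Real.sqrt (T - t) * ‖u t x‖ ≤ C * Real.sqrt ν)
    {ε : ℝ} (hε : 0 < ε) :
    ∃ t₀ ∈ Ico 0 T, ∀ t ∈ Ico t₀ T,
      ∫⁻ x, ‖curl (u t) x‖ₑ ^ 2 ≤ ENNReal.ofReal (ε / (T - t)) := by
  obtain ⟨t₁, ht₁, hTt₁, hwin⟩ := lintegral_curl_sq_le_exp_div_mul_window hν hT hsol hLH hdec hrate
  set c : ℝ := Real.exp ((max C 1) ^ 2 / 2) with hc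
  have hc0 : 0 < c := Real.exp_pos _
  -- terminal dissipation below `ε / c`
  have hεc : ENNReal.ofReal (ε / c) ≠ 0 := (ENNReal.ofReal_pos.2 (div_pos hε hc0)).ne'
  obtain ⟨a₁, ha₁, hsmall⟩ := exists_window_lt hν hT hsol hLH hdec hεc
  -- `t₀ = max t₁ ((T + a₁)/2)`: then `2t − T ≥ a₁` for `t ≥ t₀`
  set t₀ : ℝ := max t₁ ((T + a₁) / 2) with ht₀
  have ht₀0 : 0 ≤ t₀ := ht₁.1.trans (le_max_left _ _)
  have ht₀T : t₀ < T := max_lt ht₁.2 (by linarith [ha₁.2])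
  refine ⟨t₀, ⟨ht₀0, ht₀T⟩, fun t ht => ?_⟩
  have htt₁ : t ∈ Ico t₁ T := ⟨(le_max_left _ _).trans ht.1, ht.2⟩
  have hat : a₁ ≤ 2 * t - T := by
    have h2 : (T + a₁) / 2 ≤ t := (le_max_right _ _).trans ht.1
    linarith
  have hδ0 : 0 < T - t := sub_pos.2 ht.2
  -- the backward window integral is below `ε / c`
  have hW : ∫⁻ s in Ioo (2 * t - T) t, ∫⁻ x, ‖curl (u s) x‖ₑ ^ 2 ≤ ENNReal.ofReal (ε / c) :=
    ((lintegral_mono_set (Ioo_subset_Ioo hat ht.2.le)).trans hsmall.le)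
  calc ∫⁻ x, ‖curl (u t) x‖ₑ ^ 2
      ≤ ENNReal.ofReal (c / (T - t)) * ∫⁻ s in Ioo (2 * t - T) t, ∫⁻ x, ‖curl (u s) x‖ₑ ^ 2 :=
        hwin t htt₁
    _ ≤ ENNReal.ofReal (c / (T - t)) * ENNReal.ofReal (ε / c) := mul_le_mul_right hW _
    _ = ENNReal.ofReal (ε / (T - t)) := by
        rw [← ENNReal.ofReal_mul (div_pos hc0 hδ0).le]
        congr 1
        field_simp

open Summit.NavierStokesRegularity.NavierStokesRegularity.Theses.TypeIQuarterGate

/-- **BY NAME, under K1's hypotheses verbatim: the enstrophy of a sup-norm Type-I blow-up is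
`o((T−t)⁻¹)`.**  For a maximal classical Leray–Hopf solution on `[0,T)` from a rapidly decaying datum
with `IsTypeIBlowup u T`: for every `ε > 0` there is `t₀ ∈ [0,T)` with `∫‖curl u(t)‖² ≤ ε/(T−t)` on
`[t₀,T)`.  (Compare the crux `QuarterLawTypeI` — `≤ K/√(T−t)` — which remains OPEN, and the tree's
exponent-`1` cap `QuarterLawExponent.enstrophyCapTypeI` — `≤ K/(T−t)` — which this refines.) [folklore] -/
theorem enstrophy_isLittleO_inv_of_isTypeIBlowup :
    ∀ (ν T : ℝ), 0 < ν → 0 < T →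
      ∀ (u : ℝ → EuclideanSpace ℝ (Fin 3) → EuclideanSpace ℝ (Fin 3))
        (p : ℝ → EuclideanSpace ℝ (Fin 3) → ℝ),
        IsMaximalSmoothSolution ν 0 u p T → IsLerayHopfOn T ν 0 (u 0) u →
        HasRapidSpatialDecay (u 0) → IsTypeIBlowup u T →
        ∀ ε : ℝ, 0 < ε → ∃ t₀ ∈ Ico 0 T, ∀ t ∈ Ico t₀ T,
          ∫⁻ x, ‖curl (u t) x‖ₑ ^ 2 ≤ ENNReal.ofReal (ε / (T - t)) := by
  intro ν T hν hT u p hmax hLH hdec hI ε hε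
  obtain ⟨C, hC⟩ := exists_rate_of_isTypeIBlowup' hν hI
  exact lintegral_curl_sq_le_eps_div hν hT hmax.1 hLH hdec hC hε

/-- **Corollary (the exponent-`1` cap is not attained).** Under K1's hypotheses, `(T−t)·∫‖curl u(t)‖²`
tends to `0` as `t ↑ T` — stated without limits: for every `ε > 0`, eventually
`ENNReal.ofReal (T − t) * ∫‖curl u(t)‖² ≤ ENNReal.ofReal ε`. [folklore] -/
theorem mul_enstrophy_le_of_isTypeIBlowup {ν T : ℝ} (hν : 0 < ν) (hT : 0 < T)
    {u : ℝ → EuclideanSpace ℝ (Fin 3) → EuclideanSpace ℝ (Fin 3)}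
    {p : ℝ → EuclideanSpace ℝ (Fin 3) → ℝ}
    (hmax : IsMaximalSmoothSolution ν 0 u p T) (hLH : IsLerayHopfOn T ν 0 (u 0) u)
    (hdec : HasRapidSpatialDecay (u 0)) (hI : IsTypeIBlowup u T) {ε : ℝ} (hε : 0 < ε) :
    ∃ t₀ ∈ Ico 0 T, ∀ t ∈ Ico t₀ T,
      ENNReal.ofReal (T - t) * ∫⁻ x, ‖curl (u t) x‖ₑ ^ 2 ≤ ENNReal.ofReal ε := by
  obtain ⟨t₀, ht₀, h⟩ :=
    enstrophy_isLittleO_inv_of_isTypeIBlowup ν T hν hT u p hmax hLH hdec hI ε hε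
  refine ⟨t₀, ht₀, fun t ht => ?_⟩
  have hδ0 : 0 < T - t := sub_pos.2 ht.2
  calc ENNReal.ofReal (T - t) * ∫⁻ x, ‖curl (u t) x‖ₑ ^ 2
      ≤ ENNReal.ofReal (T - t) * ENNReal.ofReal (ε / (T - t)) := mul_le_mul_right (h t ht) _
    _ = ENNReal.ofReal ε := by
        rw [← ENNReal.ofReal_mul hδ0.le, mul_div_cancel₀ _ hδ0.ne']

end QuarterLawBackwardWindow

end Summit.NavierStokesRegularity.NavierStokesRegularity.Theorems

end
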